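import Summits.CriticalPhenomena.PercolationContinuityZ3.Theorems.FK.PressureCubeEstimates
import Summits.CriticalPhenomena.PercolationContinuityZ3.Theorems.FK.InfiniteVolumeDefs
import HarnessLib

/-!
# FK-continuity cell, FO-10a (pressure layer, file 4): the thermodynamic limit of the random-cluster pressure on `ℤ^d` exists
# along boxes and does not depend on the boundary condition — Grimmett 2006, Thm. (4.58) (existence part)

Registered R83 (cell INBOX l.6084, 2026-08-24); registry row FO-10a-g338; label PRS-D (coordinator fk-4 g187).
Cell `fk-continuity` (bschramm), row FO-10a (domain-Markov + comparison layer over FO-06); support file for the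
FK-continuity transplant (`--supports stmt-CriticalPhenomena-4575`); builds on p205010 (kernel theorem, internal audit
signed; external expert review pending). Pure proofs; no definitions, no named facts, no sorries; general `d`.
UNCONDITIONAL infinite-volume structure; it decides nothing about FH / TP_FK / the value of `p_c(q)`.

For `q ≥ 1` and `0 ≤ p ≤ 1` let `Z^b_{Λ_n} = rcPartitionFunction (finsetGraph (zdGraph d) (box d n)) p q (boxBC d b n)` be the
partition function normalising the box measure `φ^b_{Λ_n,p,q} = rcBoxMeasure d b p q n` of `InfiniteVolumeDefs.lean` (`b = false` free,
`b = true` wired), `Λ_n = [-n,n]^d`. We prove the existence of the **pressure per site**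

  `Φ(p,q) = lim_{n → ∞} |Λ_n|⁻¹ log Z^b_{Λ_n}(p,q)`, the same for `b = 0, 1`, with `0 ≤ Φ ≤ log q`

(Grimmett 2006, Thm. (4.58): "the limits exist and are independent of `ξ` and of the way in which `Λ ↑ ℤ^d`", here along boxes;
Grimmett normalises by `|E_Λ|` and uses `Y = Z/(1-p)^{|E_Λ|}`, which rescales the limit by `d = lim |E_{Λ_n}|/|Λ_n|` and shifts it by
`-log(1-p)`; the per-site normalisation is that of the tree's Ising pressure, Literature `IsingThermodynamics.pressureIn`):

* `cauchySeq_log_rcPartitionFunction_halfOpenBox_div`, `exists_tendsto_log_rcPartitionFunction_halfOpenBox_div` — the limit along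
  the cubes `C_n` from the Cauchy estimate of `PressureCubeEstimates.lean` ((4.66)–(4.67));
* `rcPartitionFunction_box_eq_halfOpenBox`, `exists_tendsto_log_rcPartitionFunction_box_free_div` — along the boxes `Λ_n` (translates
  of `C_{2n+1}`);
* `log_rcPartitionFunction_box_free_sub_wired_mem_Icc`, `tendsto_log_rcPartitionFunction_box_free_sub_wired_div` — the wired boundary
  condition costs at most `|∂ⁱⁿΛ_n| log q = o(|Λ_n|)` (Grimmett's `Y⁰_Λ e^{-κ|∂Λ|} ≤ Y¹_Λ ≤ Y⁰_Λ`, Literature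
  `log_rcPartitionFunction_free_sub_wired_mem`, `card_innerBoundary_box_le`);
* **`exists_forall_tendsto_log_rcPartitionFunction_box_div`** — ONE limit `Φ(p,q) ∈ [0, log q]` for both boundary conditions.

Honest framing: existence of a thermodynamic limit; no statement about `p_c(q)`; NOT a binder discharge, NOT `_r4`.

## References

* G. Grimmett, *The Random-Cluster Model*, Springer 2006 (`book:grimmett2006-random-cluster-model`): §4.5, Thm. (4.58) and its
  proof, (4.65)–(4.71) [PDF pp. 88–92]. [Grimmett2006]
* S. Friedli, Y. Velenik, *Statistical Mechanics of Lattice Systems*, CUP 2017, Thm. 3.6 (the template of the argument).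
  [FriedliVelenik2017]
-/

noncomputable section

open Finset Filter Topology

namespace Summit.CriticalPhenomena.PercolationContinuityZ3.Theorems.FK

open Literature.Probability.Percolation Literature.Probability.LatticeModels

variable (d : ℕ)

/-! ### The limit along cubes and boxes, both boundary conditions -/

section Limit

/-- **The pressures of the cubes form a Cauchy sequence** (Grimmett 2006, proof of Thm. (4.58), (4.66)–(4.67): the limit
`H(p,q) = lim |n|⁻¹ log Z_{Λ_n}` exists). [cite: Grimmett2006, proof of Thm. (4.58), (4.66)–(4.67)] -/
theorem cauchySeq_log_rcPartitionFunction_halfOpenBox_div {p q : ℝ} (hp : p ∈ Set.Icc (0 : ℝ) 1) (hq : 1 ≤ q) :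
    CauchySeq fun n : ℕ =>
      Real.log (rcPartitionFunction (finsetGraph (zdGraph d) (halfOpenBox d n)) p q ∅) / (n : ℝ) ^ d := by
  set F : ℕ → ℝ := fun n =>
    Real.log (rcPartitionFunction (finsetGraph (zdGraph d) (halfOpenBox d n)) p q ∅) / (n : ℝ) ^ d with hF
  set C : ℝ := (2 * Real.log q + 2 * d * Real.log q) * d with hC
  set g : ℕ → ℝ := fun n => Real.log q * (2 * d * (((n : ℝ) + 2) ^ d - (n : ℝ) ^ d)) / (n : ℝ) ^ d with hg
  have star : ∀ {n m : ℕ}, 1 ≤ n → n ≤ m → |F m - F n| ≤ C * ((n : ℝ) / m) + g n :=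
    fun hn hnm => abs_log_rcPartitionFunction_halfOpenBox_div_sub_le d hp hq hn hnm
  rw [Metric.cauchySeq_iff]
  intro ε hε
  have hε4 : 0 < ε / 4 := by positivity
  -- choose `n` with the boundary term small
  have hg0 : Tendsto g atTop (𝓝 0) := by
    have h1 := (tendsto_pow_add_two_sub_pow_div d
      (tendsto_natCast_atTop_atTop (R := ℝ))).const_mul (Real.log q * (2 * d))
    rw [mul_zero] at h1
    refine h1.congr' (Eventually.of_forall fun n => ?_)
    simp only [hg]
    ring
  obtain ⟨n, hgn, hn1⟩ := ((hg0.eventually (Iio_mem_nhds hε4)).and (eventually_ge_atTop 1)).exists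
  have hgn' : g n < ε / 4 := hgn
  -- choose `N` with `C n / m` small for `m ≥ N`
  have hc0 : Tendsto (fun m : ℕ => C * ((n : ℝ) / m)) atTop (𝓝 0) := by
    have h1 := ((tendsto_const_nhds (x := (n : ℝ))).div_atTop
      (tendsto_natCast_atTop_atTop (R := ℝ))).const_mul C
    rwa [mul_zero] at h1
  obtain ⟨N, hN⟩ := eventually_atTop.1 ((hc0.eventually (Iio_mem_nhds hε4)).and
    (eventually_ge_atTop n))
  have key : ∀ m ≥ N, |F m - F n| < ε / 2 := by
    intro m hm
    obtain ⟨hcm, hnm⟩ := hN m hm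
    have hcm' : C * ((n : ℝ) / m) < ε / 4 := hcm
    have := star hn1 hnm
    linarith
  refine ⟨N, fun m hm m' hm' => ?_⟩
  rw [Real.dist_eq]
  calc |F m - F m'| ≤ |F m - F n| + |F n - F m'| := abs_sub_le _ _ _
    _ = |F m - F n| + |F m' - F n| := by rw [abs_sub_comm (F n)]
    _ < ε := by linarith [key m hm, key m' hm']

/-- **Existence of the pressure along the cubes `C_n = {0,…,n-1}^d`**, free boundary condition, `q ≥ 1`, `0 ≤ p ≤ 1`
(Grimmett 2006, proof of Thm. (4.58), (4.67)). [cite: Grimmett2006, proof of Thm. (4.58), (4.67)] -/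
theorem exists_tendsto_log_rcPartitionFunction_halfOpenBox_div {p q : ℝ} (hp : p ∈ Set.Icc (0 : ℝ) 1) (hq : 1 ≤ q) :
    ∃ Φ : ℝ, Tendsto (fun n : ℕ =>
      Real.log (rcPartitionFunction (finsetGraph (zdGraph d) (halfOpenBox d n)) p q ∅) / (n : ℝ) ^ d)
      atTop (𝓝 Φ) :=
  cauchySeq_tendsto_of_complete (cauchySeq_log_rcPartitionFunction_halfOpenBox_div d hp hq)

/-! ### The box sequence `Λ_n = [-n,n]^d` and the boundary condition -/

/-- The free box partition function is that of the cube `C_{2n+1}` (translation invariance).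
[cite: Grimmett2006, proof of Thm. (4.58) (translation invariance of Z_Λ)] -/
theorem rcPartitionFunction_box_eq_halfOpenBox (p q : ℝ) (n : ℕ) :
    rcPartitionFunction (finsetGraph (zdGraph d) (box d n)) p q ∅ =
      rcPartitionFunction (finsetGraph (zdGraph d) (halfOpenBox d (2 * n + 1))) p q ∅ := by
  rw [box_eq_map_shift_halfOpenBox, rcPartitionFunction_finsetGraph_map_shift]

/-- **Existence of the free pressure per site along the boxes `Λ_n`**: `|Λ_n|⁻¹ log Z⁰_{Λ_n}(p,q)` converges (`q ≥ 1`,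
`0 ≤ p ≤ 1`). [cite: Grimmett2006, Thm. (4.58) with (4.69)] -/
theorem exists_tendsto_log_rcPartitionFunction_box_free_div {p q : ℝ} (hp : p ∈ Set.Icc (0 : ℝ) 1) (hq : 1 ≤ q) :
    ∃ Φ : ℝ, Tendsto (fun n : ℕ =>
      Real.log (rcPartitionFunction (finsetGraph (zdGraph d) (box d n)) p q ∅) / (#(box d n) : ℝ)) atTop (𝓝 Φ) := by
  obtain ⟨Φ, hΦ⟩ := exists_tendsto_log_rcPartitionFunction_halfOpenBox_div d hp hq
  refine ⟨Φ, ?_⟩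
  have h2 : Tendsto (fun n : ℕ => 2 * n + 1) atTop atTop :=
    tendsto_atTop_atTop.2 fun b => ⟨b, fun a ha => by omega⟩
  refine (hΦ.comp h2).congr fun n => ?_
  rw [Function.comp_apply, rcPartitionFunction_box_eq_halfOpenBox, card_box, Nat.cast_pow]

/-- **The wired boundary condition costs at most `|∂Λ_n| log q`**: `0 ≤ log Z⁰_{Λ_n} - log Z¹_{Λ_n} ≤ |∂ⁱⁿΛ_n| log q`
(Grimmett 2006, proof of Thm. (4.58): `Y⁰_Λ e^{-κ|∂Λ|} ≤ Y^ξ_Λ ≤ Y⁰_Λ`; Literature `log_rcPartitionFunction_free_sub_wired_mem`).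
[cite: Grimmett2006, proof of Thm. (4.58), (4.71)] -/
theorem log_rcPartitionFunction_box_free_sub_wired_mem_Icc {p q : ℝ} (hp : p ∈ Set.Icc (0 : ℝ) 1) (hq : 1 ≤ q) (n : ℕ) :
    Real.log (rcPartitionFunction (finsetGraph (zdGraph d) (box d n)) p q (boxBC d false n)) -
        Real.log (rcPartitionFunction (finsetGraph (zdGraph d) (box d n)) p q (boxBC d true n)) ∈
      Set.Icc 0 ((#(innerBoundary (zdGraph d) (box d n)) : ℝ) * Real.log q) := by
  classical
  set B : Finset ↥(box d n) := Finset.univ.filter fun x => x.1 ∈ innerBoundary (zdGraph d) (box d n) with hB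
  have hBc : (↑B : Set ↥(box d n)) = wiredBoundary (zdGraph d) (box d n) := by
    ext x
    rw [Finset.mem_coe, hB, Finset.mem_filter, mem_wiredBoundary_iff]
    simp
  have hcardB : #B ≤ #(innerBoundary (zdGraph d) (box d n)) := by
    refine Finset.card_le_card_of_injOn (fun x => x.1) (fun x hx => ?_) (fun x _ y _ h => Subtype.ext h)
    rw [Finset.mem_coe, hB, Finset.mem_filter] at hx
    exact hx.2
  have h := log_rcPartitionFunction_free_sub_wired_mem (finsetGraph (zdGraph d) (box d n)) hp hq B
  rw [hBc] at h
  have h0 : boxBC d false n = (∅ : Set ↥(box d n)) := rfl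
  have h1 : boxBC d true n = wiredBoundary (zdGraph d) (box d n) := rfl
  rw [h0, h1]
  refine ⟨h.1, h.2.trans ?_⟩
  refine mul_le_mul_of_nonneg_right ?_ (Real.log_nonneg hq)
  refine (max_le ?_ ?_)
  · have : (#B : ℝ) ≤ #(innerBoundary (zdGraph d) (box d n)) := by exact_mod_cast hcardB
    linarith
  · exact Nat.cast_nonneg _

/-- **The boundary condition is negligible along boxes**: `|Λ_n|⁻¹ (log Z⁰_{Λ_n} - log Z¹_{Λ_n}) → 0`
(`|∂ⁱⁿΛ_n| ≤ 2d(2n+1)^{d-1}` against `|Λ_n| = (2n+1)^d`). [cite: Grimmett2006, proof of Thm. (4.58), (4.71)] -/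
theorem tendsto_log_rcPartitionFunction_box_free_sub_wired_div {p q : ℝ} (hp : p ∈ Set.Icc (0 : ℝ) 1) (hq : 1 ≤ q) :
    Tendsto (fun n : ℕ =>
      (Real.log (rcPartitionFunction (finsetGraph (zdGraph d) (box d n)) p q (boxBC d false n)) -
          Real.log (rcPartitionFunction (finsetGraph (zdGraph d) (box d n)) p q (boxBC d true n))) /
        (#(box d n) : ℝ)) atTop (𝓝 0) := by
  -- `2d (2n+1)^{d-1} log q / (2n+1)^d = 2d log q / (2n+1) → 0`
  have h0 : Tendsto (fun n : ℕ => 2 * (n : ℝ) + 1) atTop atTop :=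
    tendsto_atTop_mono (fun n => by linarith [(Nat.cast_nonneg n : (0 : ℝ) ≤ n)])
      tendsto_natCast_atTop_atTop
  have he : Tendsto (fun n : ℕ => 2 * d * Real.log q / (2 * (n : ℝ) + 1)) atTop (𝓝 0) :=
    tendsto_const_nhds.div_atTop h0
  refine squeeze_zero_norm' (Eventually.of_forall fun n => ?_) he
  have hmem := log_rcPartitionFunction_box_free_sub_wired_mem_Icc d hp hq n
  have hcard : (#(box d n) : ℝ) = (2 * (n : ℝ) + 1) ^ d := by rw [card_box]; push_cast; ring
  have hpos : (0 : ℝ) < 2 * (n : ℝ) + 1 := by positivity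
  rw [Real.norm_eq_abs, abs_div, abs_of_nonneg hmem.1, abs_of_pos (by rw [hcard]; positivity), hcard,
    div_le_div_iff₀ (pow_pos hpos d) hpos]
  have hinner : (#(innerBoundary (zdGraph d) (box d n)) : ℝ) ≤ 2 * d * (2 * (n : ℝ) + 1) ^ (d - 1) := by
    exact_mod_cast card_innerBoundary_box_le n (d := d)
  rcases Nat.eq_zero_or_pos d with hd | hd
  · subst hd
    have : innerBoundary (zdGraph 0) (box 0 n) = ∅ := by
      rw [Finset.eq_empty_iff_forall_notMem]
      intro x hx
      rw [mem_innerBoundary_iff] at hx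
      obtain ⟨-, y, -, hxy⟩ := hx
      obtain ⟨i, -⟩ := (zdGraph_adj_iff x y).1 hxy
      exact i.elim0
    rw [this] at hmem
    simp only [Finset.card_empty, Nat.cast_zero, zero_mul, Set.mem_Icc] at hmem
    have h00 : Real.log (rcPartitionFunction (finsetGraph (zdGraph 0) (box 0 n)) p q (boxBC 0 false n)) -
        Real.log (rcPartitionFunction (finsetGraph (zdGraph 0) (box 0 n)) p q (boxBC 0 true n)) = 0 :=
      le_antisymm hmem.2 hmem.1
    rw [h00, zero_mul]
    simp
  · calc (Real.log (rcPartitionFunction (finsetGraph (zdGraph d) (box d n)) p q (boxBC d false n)) -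
            Real.log (rcPartitionFunction (finsetGraph (zdGraph d) (box d n)) p q (boxBC d true n))) *
            (2 * (n : ℝ) + 1)
        ≤ (#(innerBoundary (zdGraph d) (box d n)) : ℝ) * Real.log q * (2 * (n : ℝ) + 1) :=
          mul_le_mul_of_nonneg_right hmem.2 hpos.le
      _ ≤ 2 * d * (2 * (n : ℝ) + 1) ^ (d - 1) * Real.log q * (2 * (n : ℝ) + 1) :=
          mul_le_mul_of_nonneg_right (mul_le_mul_of_nonneg_right hinner (Real.log_nonneg hq)) hpos.le
      _ = 2 * d * Real.log q * (2 * (n : ℝ) + 1) ^ d := by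
          have hpow : (2 * (n : ℝ) + 1) ^ d = (2 * (n : ℝ) + 1) ^ (d - 1) * (2 * (n : ℝ) + 1) := by
            rw [← pow_succ, Nat.sub_add_cancel hd]
          rw [hpow]
          ring

/-- **Grimmett 2006, Thm. (4.58) (existence and boundary-condition independence of the pressure), per-site normalisation,
along the boxes `Λ_n = [-n,n]^d` of `ℤ^d`**: for `q ≥ 1` and `0 ≤ p ≤ 1` there is ONE real `Φ = Φ(p,q)` (`0 ≤ Φ ≤ log q`) with
`|Λ_n|⁻¹ log Z^b_{Λ_n}(p,q) → Φ` for BOTH the free (`b = false`) and the wired (`b = true`) box partition functions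
`Z^b_{Λ_n} = rcPartitionFunction (finsetGraph (zdGraph d) (box d n)) p q (boxBC d b n)` (the normalisations of `rcBoxMeasure d b p q n`).
[cite: Grimmett2006, Thm. (4.58)] -/
theorem exists_forall_tendsto_log_rcPartitionFunction_box_div {p q : ℝ} (hp : p ∈ Set.Icc (0 : ℝ) 1) (hq : 1 ≤ q) :
    ∃ Φ : ℝ, Φ ∈ Set.Icc 0 (Real.log q) ∧ ∀ b : Bool, Tendsto (fun n : ℕ =>
      Real.log (rcPartitionFunction (finsetGraph (zdGraph d) (box d n)) p q (boxBC d b n)) / (#(box d n) : ℝ))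
        atTop (𝓝 Φ) := by
  obtain ⟨Φ, hΦ⟩ := exists_tendsto_log_rcPartitionFunction_box_free_div d hp hq
  have hfree : Tendsto (fun n : ℕ =>
      Real.log (rcPartitionFunction (finsetGraph (zdGraph d) (box d n)) p q (boxBC d false n)) / (#(box d n) : ℝ))
        atTop (𝓝 Φ) := hΦ
  have hwired : Tendsto (fun n : ℕ =>
      Real.log (rcPartitionFunction (finsetGraph (zdGraph d) (box d n)) p q (boxBC d true n)) / (#(box d n) : ℝ))
        atTop (𝓝 Φ) := by
    have h := hfree.sub (tendsto_log_rcPartitionFunction_box_free_sub_wired_div d hp hq)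
    rw [sub_zero] at h
    refine h.congr fun n => ?_
    rw [sub_div]
    ring
  -- `0 ≤ Φ ≤ log q` from the a priori bound `0 ≤ log Z⁰_Λ ≤ |Λ| log q`
  have hbounds : ∀ n : ℕ, Real.log (rcPartitionFunction (finsetGraph (zdGraph d) (box d n)) p q (boxBC d false n)) /
      (#(box d n) : ℝ) ∈ Set.Icc 0 (Real.log q) := by
    intro n
    have h := log_rcPartitionFunction_finsetGraph_mem_Icc (zdGraph d) hp hq (box d n) (boxBC d false n)
    have hpos : (0 : ℝ) < #(box d n) := by exact_mod_cast Finset.card_pos.2 (box_nonempty d n)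
    constructor
    · exact div_nonneg h.1 hpos.le
    · rw [div_le_iff₀ hpos, mul_comm]
      exact h.2
  refine ⟨Φ, ⟨?_, ?_⟩, fun b => ?_⟩
  · exact ge_of_tendsto' hfree fun n => (hbounds n).1
  · exact le_of_tendsto' hfree fun n => (hbounds n).2
  · cases b
    · exact hfree
    · exact hwired

end Limit

end Summit.CriticalPhenomena.PercolationContinuityZ3.Theorems.FK
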